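import Summits.ResolutionOfSingularities.ResolutionOfSingularities.Theorems.FrobeniusClosingSteerContentFrame
import Summits.ResolutionOfSingularities.ResolutionOfSingularities.Theorems.ValuativeLuAlphaPTorsorLocAtCentreDerivations
import Summits.ResolutionOfSingularities.ResolutionOfSingularities.Theorems.RadicialJungCleanModelsStubParameterSubset
import Literature.AlgebraicGeometry.Hironaka2017.Lib.FrobeniusPBasisEssFiniteType
import HarnessLib

/-!
# Crux `Steer` (stmt-ResolutionOfSingularities-16345), chain W4.1 — registered stub `stub_logFinalExitM`
# (r18/r19), E1 half, piece **L1 `contentFrame` INSTANTIATED** at `S = (A₁)_{𝔪_O ∩ A₁} ⊆ K`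

OURS (campaign `res-hironaka`, rung L, slot W4.1, chain W4.1; seat res-D-pv-014 AS res-L0-w41-stub-9;
replaces the role of no printed item; NOT a statement of the manuscript under review
[claim: Hironaka2017, status: under-review]; AI review is weaker than expert review). Theses-free helper for
the registered stub `stub_logFinalExitM` of the line `switching_dichotomy` (holder res-L0-w41-lead-1,
skeleton r19): the ABSTRACT frame of `FrobeniusClosingSteerContentFrame.lean` (`ContentFrame.exists_frame`)
run on the local ring at the centre of a finitely generated model.

## Statement (`ContentFrame.exists_frame_locAtCentre`)

`k ⊆ K` fields, `k` PERFECT of characteristic `p`, `O` a valuation ring of `K` which is ZERO-DIMENSIONAL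
over `k` (`ZeroDim`: every element of `O` is a root modulo `𝔪_O` of a non-zero polynomial over `k`),
`A₁ ⊆ O` a finitely generated `k`-subalgebra with `S := locAtCentre A₁ O = (A₁)_{𝔪_O ∩ A₁} ⊆ K` regular,
`f ∈ S` with INVERTIBLE CONTENT (`h ≠ 0` divides every `δ f`, `δ ∈ Der_ℤ(S)`, and some `δ₀ f = h * u`,
`u` a unit). Then there are a regular system of parameters `y : Fin (n + 1) → S` (`(y) = 𝔪_S`,
`dim S = n + 1`) and a COMMUTING, `p`-NILPOTENT family `D : Fin n → Der_ℤ(S)` killing `f` and DUAL to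
`y 1, …, y n`, such that a derivation killing `f` and `y 1, …, y n` is zero, together with an EXCHANGE
WITNESS `Δ₀ ∈ Der_ℤ(S)` (`Δ₀ f ≠ 0`, `Δ₀ (y j) = 0` for `j ≥ 1`); and `Der_ℤ(S)` is determined by the
values on `y` (Kunz `p`-basis).

## Proof

`S` is essentially of finite type over the perfect field `k` (localisation of `A₁`,
`isLocalization_locAtCentre`), hence F-finite (`S02Preliminaries.isFFinite_of_essFiniteType`, LIB-03);
its residue field is algebraic over `k` (ZERO-DIMENSIONALITY: `S ⊆ O` is dominated by `O`), hence perfect;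
so the monomials in a regular system of parameters `x` (tree:
`RadicialJung.CleanModels.exists_fin_span_eq_maximalIdeal_ringKrullDim_eq`) span `S` over `ρ(S) = S^p`
(`span_frobeniusPower_monomials_eq_top_of_isFFinite`, Kunz) and a `ℤ`-derivation killing `x` is zero
(`ContentFrame.derivation_eq_zero_of_span`). Dual derivations of `x` exist
(`PfaffLine.exists_dual_derivations_locAtCentre`, Matsumura §30), and `ContentFrame.exists_frame` applies.

Sources: H. Matsumura, *Commutative Ring Theory*, §25, §30; E. Kunz, Amer. J. Math. 91 (1969), Thm. 2.1.
[cite: Matsumura1987, §25, §30] [cite: Kunz1969, Thm. 2.1] [folklore]. No definitions.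
-/

noncomputable section

-- `Summit.<S>.<S>.…` duplicates the summit name by design (single-problem summit).
set_option linter.dupNamespace false
set_option autoImplicit false

namespace Summit.ResolutionOfSingularities.ResolutionOfSingularities.Theorems.SwitchingDichotomy

namespace ContentFrame

open IsLocalRing Polynomial
open Literature.AlgebraicGeometry.Resolution
open Literature.AlgebraicGeometry.Hironaka2017.S02Preliminaries
open Summit.ResolutionOfSingularities.ResolutionOfSingularities.Theorems.PfaffLine
  (exists_dual_derivations_locAtCentre)

section LocAtCentre

variable {k K : Type} [Field k] [Field K] [Algebra k K]

/-! ## `S = locAtCentre A₁ O` is essentially of finite type over `k`, with perfect residue field -/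

/-- The `k`-algebra structure of `locAtCentre A₁ O ⊆ K` (the inclusion `k ⊆ A₁ ⊆ (A₁)_{𝔪_O ∩ A₁}`),
as a definition-free term used locally. [folklore] -/
theorem algebraMap_mem_locAtCentre (O : ValuationSubring K) (A₁ : Subalgebra k K) (c : k) :
    algebraMap k K c ∈ locAtCentre A₁.toSubring O :=
  le_locAtCentre A₁.toSubring O (A₁.algebraMap_mem c)

/-- `locAtCentre A₁ O ⊆ K` has characteristic `p` when `k` has. [folklore] -/
theorem charP_locAtCentre (p : ℕ) [CharP k p] (O : ValuationSubring K) (A₁ : Subalgebra k K) :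
    CharP (locAtCentre A₁.toSubring O) p := by
  haveI : CharP K p := charP_of_injective_algebraMap (algebraMap k K).injective p
  exact ((locAtCentre A₁.toSubring O).subtype.charP_iff Subtype.val_injective p).mpr inferInstance

/-- **Determination by a regular system of parameters** on `S = locAtCentre A₁ O` (`k` perfect of
characteristic `p`, `A₁` finitely generated, `O` zero-dimensional over `k`, `S` regular): a `ℤ`-derivation of
`S` killing a regular system of parameters is zero — the monomials span `S` over `S^p` (Kunz) and
derivations kill `p`-th powers. [cite: Kunz1969, Thm. 2.1] [cite: Matsumura1987, §30] -/
theorem derivation_eq_zero_locAtCentre (p : ℕ) [Fact p.Prime] [CharP k p] [PerfectField k]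
    (O : ValuationSubring K) (A₁ : Subalgebra k K) (h₁ : A₁.toSubring ≤ O.toSubring) (hfg : A₁.FG)
    (hzd : ∀ x ∈ O, ∃ g : k[X], g ≠ 0 ∧ aeval x g ∈ O.nonunits)
    [IsRegularLocalRing (locAtCentre A₁.toSubring O)]
    {d : ℕ} (x : Fin d → locAtCentre A₁.toSubring O)
    (hx : Ideal.span (Set.range x) = maximalIdeal (locAtCentre A₁.toSubring O))
    (δ : Derivation ℤ (locAtCentre A₁.toSubring O) (locAtCentre A₁.toSubring O))
    (hδ : ∀ i, δ (x i) = 0) : δ = 0 := by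
  classical
  -- the `k`-algebra structure on `S := locAtCentre A₁ O` through `A₁`
  letI algA : Algebra k A₁.toSubring := A₁.algebra
  haveI : Algebra.FiniteType k A₁.toSubring := (Subalgebra.fg_iff_finiteType A₁).mp hfg
  letI algS : Algebra k (locAtCentre A₁.toSubring O) :=
    ((algebraMap A₁.toSubring (locAtCentre A₁.toSubring O)).comp (algebraMap k A₁.toSubring)).toAlgebra
  haveI : IsScalarTower k A₁.toSubring (locAtCentre A₁.toSubring O) :=
    IsScalarTower.of_algebraMap_eq fun _ => rfl
  haveI : IsScalarTower k (locAtCentre A₁.toSubring O) K := IsScalarTower.of_algebraMap_eq fun _ => rfl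
  haveI := isLocalization_locAtCentre (B := A₁.toSubring) (O := O) h₁
  haveI : Algebra.EssFiniteType A₁.toSubring (locAtCentre A₁.toSubring O) :=
    Algebra.EssFiniteType.of_isLocalization (locAtCentre A₁.toSubring O)
      (subringCentre A₁.toSubring O h₁).primeCompl
  haveI : Algebra.EssFiniteType k (locAtCentre A₁.toSubring O) :=
    Algebra.EssFiniteType.comp k A₁.toSubring (locAtCentre A₁.toSubring O)
  haveI : CharP (locAtCentre A₁.toSubring O) p := charP_of_algebra_field k p
  haveI : ExpChar k p := ExpChar.prime (Fact.out : p.Prime)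
  haveI : PerfectRing k p := PerfectField.toPerfectRing p
  -- the residue field of `S` is algebraic over `k` (zero-dimensionality of `O`), hence perfect
  haveI : Algebra.IsAlgebraic k (ResidueField (locAtCentre A₁.toSubring O)) := by
    refine ⟨fun r => ?_⟩
    obtain ⟨s, rfl⟩ := residue_surjective r
    obtain ⟨g, hg0, hg⟩ := hzd (s : K) (locAtCentre_le h₁ s.2)
    refine ⟨g, hg0, ?_⟩
    have hgs : aeval s g ∈ maximalIdeal (locAtCentre A₁.toSubring O) := by
      rw [mem_maximalIdeal_locAtCentre_iff h₁, ← ValuationSubring.mem_nonunits_iff]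
      have hK : ((aeval s g : locAtCentre A₁.toSubring O) : K) = aeval (s : K) g := by
        rw [show ((aeval s g : locAtCentre A₁.toSubring O) : K) =
            algebraMap (locAtCentre A₁.toSubring O) K (aeval s g) from rfl, ← aeval_algebraMap_apply]
        rfl
      rw [hK]
      exact hg
    rw [show residue (locAtCentre A₁.toSubring O) s =
        algebraMap (locAtCentre A₁.toSubring O) (ResidueField (locAtCentre A₁.toSubring O)) s from rfl,
      aeval_algebraMap_apply]
    exact (residue_eq_zero_iff _).mpr hgs
  haveI : PerfectField (ResidueField (locAtCentre A₁.toSubring O)) := Algebra.IsAlgebraic.perfectField k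
  -- Kunz: the monomials in `x` span `S` over `ρ(S)`
  have hF : Literature.AlgebraicGeometry.Resolution.IsFFinite p 1 (locAtCentre A₁.toSubring O) :=
    isFFinite_of_essFiniteType (𝕂 := k) p 1
  have hspan := span_frobeniusPower_monomials_eq_top_of_isFFinite (p := p) x hx hF
  refine derivation_eq_zero_of_span p (frobeniusPowerSubring (locAtCentre A₁.toSubring O) p 1)
    (fun s hs => ?_) _ hspan δ ?_
  · obtain ⟨b, hb⟩ := mem_frobeniusPowerSubring_iff.mp hs
    exact ⟨b, by rw [← hb, pow_one]⟩
  · rintro _ ⟨α, rfl⟩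
    exact apply_prod_pow_eq_zero _ x _ δ hδ

/-! ## The frame at the centre of a finitely generated model -/

/-- **L1 `contentFrame` at `S = (A₁)_{𝔪_O ∩ A₁}`.** `k` perfect of characteristic `p`; `O` a valuation ring
of `K ⊇ k`, zero-dimensional over `k`; `A₁ ⊆ O` finitely generated over `k` with `S := locAtCentre A₁ O`
regular; `f ∈ S` of invertible content (`h ≠ 0`, `h ∣ δ f` for every `δ ∈ Der_ℤ(S)`, `δ₀ f = h * u`,
`u` a unit). Then there are a regular system of parameters `y : Fin (n + 1) → S` (`(y) = 𝔪_S`,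
`dim S = n + 1`), a commuting `p`-nilpotent family `D : Fin n → Der_ℤ(S)` with `D j f = 0` and
`D i (y (j+1)) = δ_ij`, uniqueness (`δ f = 0 ∧ ∀ j, δ (y (j+1)) = 0 ⇒ δ = 0`), an exchange witness
`Δ₀` (`Δ₀ f ≠ 0`, `Δ₀ (y (j+1)) = 0`), and determination of `Der_ℤ(S)` by the values on `y`.
[cite: Matsumura1987, §25, §30] [cite: Kunz1969, Thm. 2.1] [folklore] -/
theorem exists_frame_locAtCentre (p : ℕ) [Fact p.Prime] [CharP k p] [PerfectField k]
    (O : ValuationSubring K) (A₁ : Subalgebra k K) (h₁ : A₁.toSubring ≤ O.toSubring) (hfg : A₁.FG)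
    (hzd : ∀ x ∈ O, ∃ g : k[X], g ≠ 0 ∧ aeval x g ∈ O.nonunits)
    [IsLocalRing (locAtCentre A₁.toSubring O)] (hreg : IsRegularLocalRing (locAtCentre A₁.toSubring O))
    (f : locAtCentre A₁.toSubring O) {h : locAtCentre A₁.toSubring O} (hh : h ≠ 0)
    (hdiv : ∀ δ : Derivation ℤ (locAtCentre A₁.toSubring O) (locAtCentre A₁.toSubring O), h ∣ δ f)
    (δ₀ : Derivation ℤ (locAtCentre A₁.toSubring O) (locAtCentre A₁.toSubring O))
    {u : locAtCentre A₁.toSubring O} (hu : IsUnit u) (hδ₀ : δ₀ f = h * u) :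
    ∃ (n : ℕ) (y : Fin (n + 1) → locAtCentre A₁.toSubring O)
      (D : Fin n → Derivation ℤ (locAtCentre A₁.toSubring O) (locAtCentre A₁.toSubring O)),
      Ideal.span (Set.range y) = maximalIdeal (locAtCentre A₁.toSubring O) ∧
      ringKrullDim (locAtCentre A₁.toSubring O) = ((n + 1 : ℕ) : WithBot ℕ∞) ∧
      (∀ j, D j f = 0) ∧
      (∀ i j, D i (y j.succ) = if i = j then 1 else 0) ∧
      (∀ i j b, D i (D j b) = D j (D i b)) ∧
      (∀ i b, (⇑(D i))^[p] b = 0) ∧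
      (∀ δ : Derivation ℤ (locAtCentre A₁.toSubring O) (locAtCentre A₁.toSubring O),
        δ f = 0 → (∀ j : Fin n, δ (y j.succ) = 0) → δ = 0) ∧
      (∃ Δ₀ : Derivation ℤ (locAtCentre A₁.toSubring O) (locAtCentre A₁.toSubring O),
        Δ₀ f ≠ 0 ∧ ∀ j : Fin n, Δ₀ (y j.succ) = 0) ∧
      (∀ δ : Derivation ℤ (locAtCentre A₁.toSubring O) (locAtCentre A₁.toSubring O),
        (∀ i, δ (y i) = 0) → δ = 0) := by
  classical
  haveI := hreg
  haveI : CharP (locAtCentre A₁.toSubring O) p := charP_locAtCentre p O A₁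
  -- a regular system of parameters and its dual derivations
  obtain ⟨d, x, hx, hdim⟩ :=
    RadicialJung.CleanModels.exists_fin_span_eq_maximalIdeal_ringKrullDim_eq (locAtCentre A₁.toSubring O)
  obtain ⟨Δ, hΔ⟩ := exists_dual_derivations_locAtCentre p k K O A₁ h₁ hfg x hx hdim
  -- determination (Kunz)
  have hdet : ∀ δ : Derivation ℤ (locAtCentre A₁.toSubring O) (locAtCentre A₁.toSubring O),
      (∀ i, δ (x i) = 0) → δ = 0 :=
    fun δ hδ => derivation_eq_zero_locAtCentre p O A₁ h₁ hfg hzd x hx δ hδ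
  -- the abstract frame
  obtain ⟨n, e, D, hDf, hDy, hcomm, hnil, huniq, hΔ0f, hΔ0y⟩ :=
    exists_frame p x Δ hΔ hdet hh hdiv δ₀ hu hδ₀
  have hd : d = n + 1 := by simpa using (Fintype.card_congr e).symm
  subst hd
  refine ⟨n, x ∘ e, D, ?_, hdim, hDf, hDy, hcomm, hnil, huniq, ⟨Δ (e 0), hΔ0f, hΔ0y⟩,
    fun δ hδ => det_reindex x hdet e δ hδ⟩
  rw [← hx, Set.range_comp, e.surjective.range_eq, Set.image_univ]

end LocAtCentre

end ContentFrame

end Summit.ResolutionOfSingularities.ResolutionOfSingularities.Theorems.SwitchingDichotomy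

/-! ## Appendix (append #1): the Kunz basis at the centre, exported for the degree count of L3½ -/

namespace Summit.ResolutionOfSingularities.ResolutionOfSingularities.Theorems.SwitchingDichotomy

namespace ContentFrame

open IsLocalRing Polynomial
open Literature.AlgebraicGeometry.Resolution
open Literature.AlgebraicGeometry.Hironaka2017.S02Preliminaries

variable {k K : Type} [Field k] [Field K] [Algebra k K]

/-- **Kunz basis at `S = (A₁)_{𝔪_O ∩ A₁}`.** `k` perfect of characteristic `p`; `O` zero-dimensional over `k`;
`A₁ ⊆ O` finitely generated with `S := locAtCentre A₁ O` regular; `x : Fin d → S` a regular system of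
parameters (`(x) = 𝔪_S`, `dim S = d`). Then the monomials `x^α`, `α : Fin d → Fin p`, form a BASIS of `S` over
`ρ(S) = S^p` — LIB-03's `exists_basis_frobeniusPower_monomials` (level `e = 1`) with its standing hypotheses
discharged as in `derivation_eq_zero_locAtCentre` (e.f.t. over the perfect `k` ⇒ F-finite; residue field
algebraic over `k` ⇒ perfect). In particular `S` is free of rank `p ^ d` over `S^p`, whence
`[Frac S : (Frac S)^p] = p ^ d` for the degree count «`B = S ∩ K^p`». [cite: Kunz1969, Thm. 2.1] -/
theorem exists_kunzBasis_locAtCentre (p : ℕ) [Fact p.Prime] [CharP k p] [PerfectField k]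
    (O : ValuationSubring K) (A₁ : Subalgebra k K) (h₁ : A₁.toSubring ≤ O.toSubring) (hfg : A₁.FG)
    (hzd : ∀ x ∈ O, ∃ g : k[X], g ≠ 0 ∧ aeval x g ∈ O.nonunits)
    [IsRegularLocalRing (locAtCentre A₁.toSubring O)] [CharP (locAtCentre A₁.toSubring O) p]
    {d : ℕ} (x : Fin d → locAtCentre A₁.toSubring O)
    (hx : Ideal.span (Set.range x) = maximalIdeal (locAtCentre A₁.toSubring O))
    (hdim : ringKrullDim (locAtCentre A₁.toSubring O) = (d : WithBot ℕ∞)) :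
    ∃ b : Module.Basis (Fin d → Fin (p ^ 1)) (frobeniusPowerSubring (locAtCentre A₁.toSubring O) p 1)
        (locAtCentre A₁.toSubring O), ∀ α, b α = ∏ i, x i ^ (α i : ℕ) := by
  classical
  -- the `k`-algebra structure on `S := locAtCentre A₁ O` through `A₁`
  letI algA : Algebra k A₁.toSubring := A₁.algebra
  haveI : Algebra.FiniteType k A₁.toSubring := (Subalgebra.fg_iff_finiteType A₁).mp hfg
  letI algS : Algebra k (locAtCentre A₁.toSubring O) :=
    ((algebraMap A₁.toSubring (locAtCentre A₁.toSubring O)).comp (algebraMap k A₁.toSubring)).toAlgebra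
  haveI : IsScalarTower k A₁.toSubring (locAtCentre A₁.toSubring O) :=
    IsScalarTower.of_algebraMap_eq fun _ => rfl
  haveI : IsScalarTower k (locAtCentre A₁.toSubring O) K := IsScalarTower.of_algebraMap_eq fun _ => rfl
  haveI := isLocalization_locAtCentre (B := A₁.toSubring) (O := O) h₁
  haveI : Algebra.EssFiniteType A₁.toSubring (locAtCentre A₁.toSubring O) :=
    Algebra.EssFiniteType.of_isLocalization (locAtCentre A₁.toSubring O)
      (subringCentre A₁.toSubring O h₁).primeCompl
  haveI : Algebra.EssFiniteType k (locAtCentre A₁.toSubring O) :=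
    Algebra.EssFiniteType.comp k A₁.toSubring (locAtCentre A₁.toSubring O)
  haveI : ExpChar k p := ExpChar.prime (Fact.out : p.Prime)
  haveI : PerfectRing k p := PerfectField.toPerfectRing p
  -- the residue field of `S` is algebraic over `k` (zero-dimensionality of `O`), hence perfect
  haveI : Algebra.IsAlgebraic k (ResidueField (locAtCentre A₁.toSubring O)) := by
    refine ⟨fun r => ?_⟩
    obtain ⟨s, rfl⟩ := residue_surjective r
    obtain ⟨g, hg0, hg⟩ := hzd (s : K) (locAtCentre_le h₁ s.2)
    refine ⟨g, hg0, ?_⟩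
    have hgs : aeval s g ∈ maximalIdeal (locAtCentre A₁.toSubring O) := by
      rw [mem_maximalIdeal_locAtCentre_iff h₁, ← ValuationSubring.mem_nonunits_iff]
      have hK : ((aeval s g : locAtCentre A₁.toSubring O) : K) = aeval (s : K) g := by
        rw [show ((aeval s g : locAtCentre A₁.toSubring O) : K) =
            algebraMap (locAtCentre A₁.toSubring O) K (aeval s g) from rfl, ← aeval_algebraMap_apply]
        rfl
      rw [hK]
      exact hg
    rw [show residue (locAtCentre A₁.toSubring O) s =
        algebraMap (locAtCentre A₁.toSubring O) (ResidueField (locAtCentre A₁.toSubring O)) s from rfl,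
      aeval_algebraMap_apply]
    exact (residue_eq_zero_iff _).mpr hgs
  haveI : PerfectField (ResidueField (locAtCentre A₁.toSubring O)) := Algebra.IsAlgebraic.perfectField k
  have hF : Literature.AlgebraicGeometry.Resolution.IsFFinite p 1 (locAtCentre A₁.toSubring O) :=
    isFFinite_of_essFiniteType (𝕂 := k) p 1
  have hd : (maximalIdeal (locAtCentre A₁.toSubring O)).spanFinrank = d := by
    have h := IsRegularLocalRing.spanFinrank_maximalIdeal (R := locAtCentre A₁.toSubring O)
    rw [hdim] at h
    exact_mod_cast h
  exact exists_basis_frobeniusPower_monomials (p := p) hd x hx hF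

end ContentFrame

end Summit.ResolutionOfSingularities.ResolutionOfSingularities.Theorems.SwitchingDichotomy
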